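import Literature.NumberTheory.LFunctions.DobnerSelbergClassSteepest
import Literature.NumberTheory.LFunctions.DobnerSelbergClassLemma3Proofs
import Literature.NumberTheory.LFunctions.DobnerSelbergClassConvexityProofs
import Literature.NumberTheory.LFunctions.DobnerNewmanProofs
import Mathlib.Analysis.SpecialFunctions.Gaussian.FourierTransform
import HarnessLib

/-!
# Dobner §3.1 for the extended Selberg class: `Thm. 4♯ + Bohr + Lemma 3♯ ⇒ Thm. 2` (reduction)

RH-FREE literature proofs (no definitions, no named facts, no `sorry`). Trunk T-ANT
(`Literature/NumberTheory/LFunctions`); node N5 ("N5-RED", hypothesis form) of the plan of record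
for the discharge of `Literature.NumberTheory.LFunctions.dobner_theorem2` (HOME/drafts/rt/t7-N1-PLAN.md
§5; rt-lead ruling (27), rt/STATUS 2026-08-26). Companion of `DobnerSelbergClass.lean` (the class
`𝒮♯`, the datum `Literature.NumberTheory.LFunctions.ExtendedSelbergDatum`, `H_t = D.Ht`,
`ξ^F_t = D.xiDeformed`, the named fact `dobner_theorem2`), `DobnerSelbergClassSteepest.lean`
(`J_t = D.dobnerJ`, `γ_t = D.dobnerGammaT`), `DobnerSelbergClassDeformed.lean` (`F_t = D.Ft`),
`DobnerSelbergClassLemma3Proofs.lean` (Lemma 3♯: `D.Ft_exists_zero`),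
`DobnerSelbergClassConvexityProofs.lean` (`x ↦ ξ^F((1+ix)/2)` integrable) and of the `ζ`-case file
`DobnerNewmanProofs.lean` (`Literature.NumberTheory.LFunctions.rodgers_tao_of_dobner`), whose
argument is ported here verbatim to a general datum.

> A. Dobner, *A proof of Newman's conjecture for the extended Selberg class*, Acta Arith. 201
> (2021), 29–62 = arXiv:2005.05142 (held; pages of the 18-page arXiv text). **§3.1 "Deducing
> Theorem 2 from Theorem 4"** (pp. 8–9): "`F_t` is everywhere absolutely convergent … it is
> entire … by Lemma 3 it has a zero `s₀` … By Theorem 5 [Bohr] and Theorem 4 … for every `ε > 0`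
> there are arbitrarily large `T` with `|ξ^F_t(J_t(s+iT))/γ_t(s+iT) − F_t(s)| < ε` on a small
> circle around `s₀` … by Rouché's theorem `ξ^F_t(J_t(s))` has a zero with `Re J_t(s) > ½` … so
> `ξ^F_t` has a zero off the critical line"; **Thm. 4** (p. 8), **Thm. 5** (Bohr, p. 9), **Lemma 3**
> (p. 9).

## Main results (all `theorem`s; 0 new facts)

* `Literature.NumberTheory.LFunctions.ExtendedSelbergDatum.not_hasOnlyRealZeros_Ht_of_approx`:
  for a datum `D` with `k ≥ 1` and `t < 0`, the conclusion of the qualitative Thm. 4♯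
  (`‖ξ^F_t(J_t(s)) − γ_t(s) F_t(s)‖ ≤ ε‖γ_t(s)‖` high in every vertical strip — taken as a
  HYPOTHESIS, in the frozen shape of `ExtendedSelbergDatum.xiDeformed_approx` of the plan, node N2)
  implies that `H_t` has a non-real zero;
* `Literature.NumberTheory.LFunctions.dobner_theorem2_of`: the same with the hypothesis quantified
  over all data and all `t < 0` gives the named fact `Literature.NumberTheory.LFunctions.dobner_theorem2`
  verbatim. When N2 lands as a theorem, `dobner_theorem2_holds` is the one-line application.

## The four `𝒮♯`-specific inputs of §3.1 (plan §5 (a)–(d)), all proved here or upstream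

* (a) `γ_t(s) ≠ 0` and `J_t`, `γ_t` holomorphic above the pole height `P = ∑|Im μᵢ|/ωᵢ`
  (`DobnerSelbergClassSteepest.lean`: `dobnerGammaT_ne_zero`, `differentiableAt_dobnerJ`,
  `differentiableAt_dobnerGammaT`);
* (b) `Re J_t(s) → +∞` as `Im s → ∞`, uniformly for `Re s` bounded below
  (`ExtendedSelbergDatum.exists_lt_dobnerJ_re`; uses `k ≥ 1`: `(|t|/2)∑ωᵢ log|ωᵢ s + μᵢ| → ∞`);
* (c) the dictionary "a zero `w` of `ξ^F_t` with `Re w ≠ ½` is a non-real zero of `H_t`"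
  (`ExtendedSelbergDatum.hasOnlyRealZeros_Ht_iff`, `DobnerSelbergClass.lean`);
* (d) `H_t` and `ξ^F_t` are ENTIRE for `t < 0` (`ExtendedSelbergDatum.differentiable_Ht`,
  `differentiable_xiDeformed`): `Φ_F` is bounded and continuous because `x ↦ ξ^F((1+ix)/2)` is
  integrable (`integrable_xi_critical_line`, from Lemma 1 + Phragmén–Lindelöf), so the kernel
  `e^{tu²}Φ_F(u)` has all exponential moments and
  `Literature.Analysis.Complex.differentiable_trigIntegral` applies;
* and `F_t ≢ 0` (`ExtendedSelbergDatum.exists_Ft_ne_zero`: a non-zero coefficient exists by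
  `exists_coeff_ne_zero_ne`, uniqueness of Dirichlet coefficients).

PROOF-ROUTE divergence (same as the `ζ` file): Hurwitz's theorem
(`Complex.eventually_exists_zero_mem_ball_of_tendstoUniformlyOn`) replaces Rouché's. No printed
STATEMENT is typed here (reduction theorem in house form; the printed Thm. 2 is the existing
named fact `dobner_theorem2`).

bears_on: N-C/N-P (COLUMN 3 DBN). WHAT THIS IS NOT: not Dobner's Thm. 2 itself (its Thm. 4♯ input,
node N2/L4 of the plan, is a hypothesis here); a criterion corpus is not a proof of anything about
`ζ`; nothing in this file bears on the truth of RH (or of GRH for `𝒮♯`).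

## References

* A. Dobner, op. cit., §3.1 (pp. 8–9), Thm. 4 (p. 8), Thm. 5 (p. 9), Lemma 3 (p. 9), §2 (pp. 5–6).
* J. B. Conway, *Functions of One Complex Variable I*, 2nd ed., VII.2.5 (Hurwitz).
-/

noncomputable section

open Complex Filter Set Topology Metric MeasureTheory

namespace Literature.NumberTheory.LFunctions

namespace ExtendedSelbergDatum

variable (D : ExtendedSelbergDatum)

/-! ### (d) `Φ_F` is bounded and continuous; `H_t`, `ξ^F_t` are entire for `t < 0` -/

/-- The unimodular factor `e^{−ixu}` of the Fourier integral defining `Φ_F`. [cite: Dobner2021, §2 p. 5 (definition of Φ_F)] -/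
private theorem norm_cexp_neg_I_mul (x u : ℝ) : ‖cexp (-(I * x * u))‖ = 1 := by
  rw [show -(I * (x : ℂ) * (u : ℂ)) = ((-(x * u) : ℝ) : ℂ) * I by push_cast; ring,
    Complex.norm_exp_ofReal_mul_I]

/-- **`Φ_F` is bounded**: `‖Φ_F(u)‖ ≤ (1/2π) ∫_ℝ ‖ξ^F((1+ix)/2)‖ dx` for every real `u` (p. 6: the
integrand of `Φ_F` "decays exponentially", so `Φ_F` is a bounded continuous Fourier transform).
[cite: Dobner2021, §2 pp. 5–6 (Φ_F)] -/
theorem norm_Phi_le (u : ℝ) :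
    ‖D.Phi u‖ ≤ 1 / (2 * Real.pi) * ∫ x : ℝ, ‖D.xi ((1 + I * x) / 2)‖ := by
  rw [Phi, norm_mul, show (1 / (2 * Real.pi) : ℂ) = ((1 / (2 * Real.pi) : ℝ) : ℂ) by push_cast; ring,
    Complex.norm_real, Real.norm_of_nonneg (by positivity)]
  gcongr
  calc ‖∫ x : ℝ, D.xi ((1 + I * x) / 2) * cexp (-(I * x * u))‖
      ≤ ∫ x : ℝ, ‖D.xi ((1 + I * x) / 2) * cexp (-(I * x * u))‖ := norm_integral_le_integral_norm _
    _ = ∫ x : ℝ, ‖D.xi ((1 + I * x) / 2)‖ := by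
        refine integral_congr_ae (Eventually.of_forall fun x ↦ ?_)
        simp only [norm_mul, norm_cexp_neg_I_mul, mul_one]

/-- **`Φ_F` is continuous** (`k ≥ 1`): dominated convergence in the Fourier integral, the
integrand being bounded by the integrable `‖ξ^F((1+ix)/2)‖`. [cite: Dobner2021, §2 pp. 5–6 (Φ_F)] -/
theorem continuous_Phi (hk : 0 < D.numGamma) : Continuous D.Phi := by
  have hi := D.integrable_xi_critical_line hk
  have hc := D.continuous_xi_critical_line
  have e : D.Phi = fun u : ℝ ↦ (1 / (2 * Real.pi) : ℂ) *
      ∫ x : ℝ, D.xi ((1 + I * x) / 2) * cexp (-(I * x * u)) := rfl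
  rw [e]
  refine continuous_const.mul ?_
  refine MeasureTheory.continuous_of_dominated
    (F := fun (u : ℝ) (x : ℝ) ↦ D.xi ((1 + I * x) / 2) * cexp (-(I * x * u)))
    (bound := fun x : ℝ ↦ ‖D.xi ((1 + I * x) / 2)‖) ?_ ?_ hi.norm ?_
  · intro u
    exact (hc.mul (by fun_prop)).aestronglyMeasurable
  · intro u
    refine Eventually.of_forall fun x ↦ ?_
    rw [norm_mul, norm_cexp_neg_I_mul, mul_one]
  · exact Eventually.of_forall fun x ↦ by fun_prop

/-- `e^{c|u|} ≤ e^{cu} + e^{−cu}`. [cite: Dobner2021, §2 p. 6 (proof of Thm. 1: exponential moments of the kernel)] -/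
private theorem exp_mul_abs_le (c u : ℝ) :
    Real.exp (c * |u|) ≤ Real.exp (c * u) + Real.exp (-c * u) := by
  rcases le_or_gt 0 u with hu | hu
  · rw [abs_of_nonneg hu]
    linarith [Real.exp_pos (-c * u)]
  · rw [abs_of_neg hu, show c * -u = -c * u by ring]
    linarith [Real.exp_pos (c * u)]

/-- For `t < 0`, `u ↦ e^{tu² + cu}` is integrable (a real Gaussian with a linear term).
[cite: Dobner2021, §2 p. 6 (proof of Thm. 1)] -/
private theorem integrable_exp_quadratic {t : ℝ} (ht : t < 0) (c : ℝ) :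
    Integrable fun u : ℝ ↦ Real.exp (t * u ^ 2 + c * u) := by
  have h := (integrable_cexp_quadratic' (b := (t : ℂ)) (by simpa using ht) (c : ℂ) 0).norm
  refine h.congr (Eventually.of_forall fun u ↦ ?_)
  dsimp only
  rw [Complex.norm_exp, add_zero,
    show (t : ℂ) * (u : ℂ) ^ 2 + (c : ℂ) * (u : ℂ) = ((t * u ^ 2 + c * u : ℝ) : ℂ) by push_cast; ring,
    Complex.ofReal_re]

/-- All exponential moments of the kernel `e^{tu²} Φ_F(u)` of `H_t` are finite when `t < 0`
(`k ≥ 1`): `Φ_F` is bounded and `∫ e^{tu² + c|u|} du < ∞`. [cite: Dobner2021, §2 p. 6 (proof of Thm. 1)] -/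
theorem integrable_kernel_exp_moment (hk : 0 < D.numGamma) {t : ℝ} (ht : t < 0) (c : ℝ) :
    Integrable fun u : ℝ ↦ ‖((Real.exp (t * u ^ 2) : ℝ) : ℂ) * D.Phi u‖ * Real.exp (c * |u|) := by
  set B : ℝ := 1 / (2 * Real.pi) * ∫ x : ℝ, ‖D.xi ((1 + I * x) / 2)‖ with hB
  have hB0 : 0 ≤ B := by
    rw [hB]; exact mul_nonneg (by positivity) (integral_nonneg fun x ↦ norm_nonneg _)
  have hΦ : ∀ u, ‖D.Phi u‖ ≤ B := D.norm_Phi_le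
  have hG : Integrable fun u : ℝ ↦
      B * (Real.exp (t * u ^ 2 + c * u) + Real.exp (t * u ^ 2 + (-c) * u)) :=
    ((integrable_exp_quadratic ht c).add (integrable_exp_quadratic ht (-c))).const_mul B
  have hmeas : AEStronglyMeasurable
      (fun u : ℝ ↦ ‖((Real.exp (t * u ^ 2) : ℝ) : ℂ) * D.Phi u‖ * Real.exp (c * |u|)) := by
    refine Continuous.aestronglyMeasurable ?_
    exact ((continuous_ofReal.comp (by fun_prop)).mul (D.continuous_Phi hk)).norm.mul (by fun_prop)
  refine hG.mono' hmeas (Eventually.of_forall fun u ↦ ?_)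
  rw [Real.norm_of_nonneg (by positivity), norm_mul, Complex.norm_real,
    Real.norm_of_nonneg (Real.exp_pos _).le]
  have h1 : Real.exp (c * |u|) ≤ Real.exp (c * u) + Real.exp (-c * u) := exp_mul_abs_le c u
  calc Real.exp (t * u ^ 2) * ‖D.Phi u‖ * Real.exp (c * |u|)
      ≤ Real.exp (t * u ^ 2) * B * (Real.exp (c * u) + Real.exp (-c * u)) := by
        gcongr
        exact hΦ u
    _ = B * (Real.exp (t * u ^ 2 + c * u) + Real.exp (t * u ^ 2 + (-c) * u)) := by
        rw [Real.exp_add, Real.exp_add]; ring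

/-- **`H_t` is entire for `t < 0`** (`k ≥ 1`): the kernel `e^{tu²}Φ_F(u)` of the trigonometric
integral `H_t(z) = ∫ e^{tu²} Φ_F(u) e^{izu} du` is continuous with all exponential moments finite,
so `Literature.Analysis.Complex.differentiable_trigIntegral` applies (p. 6: `H_t` is entire; §3.1
uses holomorphy of `ξ^F_t ∘ J_t`). [cite: Dobner2021, §2 p. 6 and §3.1 p. 9] -/
theorem differentiable_Ht (hk : 0 < D.numGamma) {t : ℝ} (ht : t < 0) : Differentiable ℂ (D.Ht t) := by
  have hK : Continuous fun u : ℝ ↦ ((Real.exp (t * u ^ 2) : ℝ) : ℂ) * D.Phi u :=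
    (continuous_ofReal.comp (by fun_prop)).mul (D.continuous_Phi hk)
  have e : D.Ht t = Literature.Analysis.Complex.trigIntegral
      (fun u : ℝ ↦ ((Real.exp (t * u ^ 2) : ℝ) : ℂ) * D.Phi u) := rfl
  rw [e]
  exact Literature.Analysis.Complex.differentiable_trigIntegral hK.aestronglyMeasurable
    (fun c ↦ D.integrable_kernel_exp_moment hk ht c)

/-- **`ξ^F_t` is entire for `t < 0`** (`k ≥ 1`), as `ξ^F_t(s) = H_t(−i(2s−1))`.
[cite: Dobner2021, §2 p. 6 and §3.1 p. 9] -/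
theorem differentiable_xiDeformed (hk : 0 < D.numGamma) {t : ℝ} (ht : t < 0) :
    Differentiable ℂ (D.xiDeformed t) := by
  have e : D.xiDeformed t = fun s : ℂ ↦ D.Ht t (-I * (2 * s - 1)) := rfl
  rw [e]
  exact (D.differentiable_Ht hk ht).comp (by fun_prop)

/-! ### (b) `Re J_t(s) → +∞` as `Im s → ∞`, uniformly for `Re s` bounded below -/

/-- **`Re J_t(s) → +∞`** (`k ≥ 1`, `t ≠ 0`): for all real `a, M` there is `Y > 0` with
`Re J_t(s) > M` whenever `Re s ≥ a` and `Im s ≥ Y`. Indeed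
`Re J_t(s) = Re s + (|t|/2)(log Q + ∑ᵢ ωᵢ log|ωᵢ s + μᵢ|)` and `|ωᵢ s + μᵢ| ≥ ωᵢ Im s/2` above twice
the pole height (§3.1, p. 9: the zero found has "`Re J_t(s) > ½`" once `T` is large).
[cite: Dobner2021, §3.1 p. 9] -/
theorem exists_lt_dobnerJ_re (hk : 0 < D.numGamma) {t : ℝ} (ht : t ≠ 0) (a M : ℝ) :
    ∃ Y : ℝ, 0 < Y ∧ ∀ s : ℂ, a ≤ s.re → Y ≤ s.im → M < (D.dobnerJ t s).re := by
  have ht' : 0 < |t| := abs_pos.2 ht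
  have hW : 0 < D.omegaSum := D.omegaSum_pos hk
  set c₀ : ℝ := ∑ i, D.omega i * Real.log (D.omega i / 2) with hc₀
  set L : ℝ := ((M - a) / (|t| / 2) - Real.log D.Q - c₀) / D.omegaSum with hL
  have hWL : D.omegaSum * L = (M - a) / (|t| / 2) - Real.log D.Q - c₀ := by
    rw [hL]; field_simp
  refine ⟨max (2 * D.poleHeight) (Real.exp L) + 1, ?_, fun s ha hy ↦ ?_⟩
  · have h1 : Real.exp L ≤ max (2 * D.poleHeight) (Real.exp L) := le_max_right _ _
    linarith [Real.exp_pos L]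
  have hP : 2 * D.poleHeight ≤ s.im := by
    linarith [le_max_left (2 * D.poleHeight) (Real.exp L)]
  have hyexp : Real.exp L < s.im := by
    linarith [le_max_right (2 * D.poleHeight) (Real.exp L)]
  have hy0 : 0 < s.im := (Real.exp_pos L).trans hyexp
  have hlogy : L < Real.log s.im := (Real.lt_log_iff_exp_lt hy0).2 hyexp
  -- each logarithm is at least `log(ωᵢ/2) + log(Im s)`
  have hterm : ∀ i, D.omega i * (Real.log (D.omega i / 2) + Real.log s.im) ≤
      D.omega i * Real.log ‖(D.omega i : ℂ) * s + D.mu i‖ := by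
    intro i
    have hω := D.omega_pos i
    refine mul_le_mul_of_nonneg_left ?_ hω.le
    rw [← Real.log_mul (by positivity) hy0.ne']
    refine Real.log_le_log (by positivity) ?_
    have := D.norm_omega_mul_add_mu_ge i hP
    convert this using 1
    ring
  have hsum : c₀ + D.omegaSum * Real.log s.im ≤
      ∑ i, D.omega i * Real.log ‖(D.omega i : ℂ) * s + D.mu i‖ := by
    have h := Finset.sum_le_sum fun i (_ : i ∈ Finset.univ) ↦ hterm i
    rw [hc₀, omegaSum, Finset.sum_mul, ← Finset.sum_add_distrib]
    refine le_of_eq_of_le ?_ h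
    refine Finset.sum_congr rfl fun i _ ↦ ?_
    ring
  rw [D.dobnerJ_re]
  have hmono : |t| / 2 * (Real.log D.Q + (c₀ + D.omegaSum * L)) <
      |t| / 2 * (Real.log D.Q + (c₀ + D.omegaSum * Real.log s.im)) := by
    have : D.omegaSum * L < D.omegaSum * Real.log s.im := mul_lt_mul_of_pos_left hlogy hW
    nlinarith
  have hkey : a + |t| / 2 * (Real.log D.Q + (c₀ + D.omegaSum * L)) = M := by
    rw [hWL]; field_simp; ring
  have h2 : |t| / 2 * (Real.log D.Q + (c₀ + D.omegaSum * Real.log s.im)) ≤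
      |t| / 2 * (Real.log D.Q + ∑ i, D.omega i * Real.log ‖(D.omega i : ℂ) * s + D.mu i‖) := by
    gcongr
  linarith

/-! ### `F_t ≢ 0` -/

/-- **`F_t` is not identically zero** (`t < 0`, `k ≥ 1`): `F` has a non-zero coefficient `aₙ`
(`exists_coeff_ne_zero_ne`), the weights `e^{(t/4)log² n}` do not vanish, and an `L`-series that
converges somewhere and vanishes for all large real `s` has all coefficients zero
(`LSeries_eventually_eq_zero_iff'`). §3.1 (p. 9) uses this when it isolates the zero `s₀` of `F_t`
by a small circle on which `F_t ≠ 0`. [cite: Dobner2021, §3.1 p. 9] -/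
theorem exists_Ft_ne_zero (hk : 0 < D.numGamma) {t : ℝ} (ht : t < 0) : ∃ s : ℂ, D.Ft t s ≠ 0 := by
  by_contra hcon
  push Not at hcon
  have hev : (fun x : ℝ ↦ LSeries (D.deformedCoeff t) x) =ᶠ[atTop] 0 :=
    Eventually.of_forall fun x ↦ hcon x
  rcases LSeries_eventually_eq_zero_iff'.1 hev with h0 | htop
  · obtain ⟨n, hn0, -, hn⟩ := D.exists_coeff_ne_zero_ne hk 0
    have h1 : zetaDeformedCoeff t n * D.coeff n = 0 := h0 n hn0
    rcases mul_eq_zero.1 h1 with h2 | h2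
    · rw [zetaDeformedCoeff] at h2
      exact (Complex.ofReal_ne_zero.2 (Real.exp_pos _).ne') h2
    · exact hn h2
  · rw [D.abscissaOfAbsConv_deformedCoeff ht] at htop
    exact bot_ne_top htop

/-! ### The deduction (§3.1) -/

/-- **Dobner's §3.1 for `F ∈ 𝒮♯`, hypothesis form: the qualitative Thm. 4♯ implies that `H_t`,
`t < 0`, has a non-real zero.** For a datum `D` with `k ≥ 1` and `t < 0`, assume the conclusion of
the plan's node N2 (`ExtendedSelbergDatum.xiDeformed_approx`, frozen signature): in every strip
`a ≤ Re s ≤ b`, for every `ε > 0`, `‖ξ^F_t(J_t(s)) − γ_t(s) F_t(s)‖ ≤ ε‖γ_t(s)‖` for `Im s ≥ y₀`.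
Then `¬ HasOnlyRealZeros (D.Ht t)`. Proof as printed (§3.1, pp. 8–9), with Hurwitz for Rouché:
`F_t` (entire, `≢ 0`) has a zero `s₀` by Lemma 3♯ (`D.Ft_exists_zero`); Bohr's theorem
(`bohr_almost_periodic_holds`, abscissa `−∞`) and the hypothesis give shifts `T_m → ∞` with
`g_m(s) := ξ^F_t(J_t(s+iT_m))/γ_t(s+iT_m) → F_t` uniformly on a small closed disc about `s₀`
(`γ_t ≠ 0`, `J_t`, `γ_t` holomorphic above the pole height; `ξ^F_t` entire); Hurwitz gives a zero
`w = J_t(s')` of `ξ^F_t` with `Re w > ½` (input (b)), hence a zero `−i(2w−1)` of `H_t` with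
non-zero imaginary part (`hasOnlyRealZeros_Ht_iff`). RH-FREE CONTENT (reduction; the N2 input is
node L4/N2 of the plan, not yet a theorem). [cite: Dobner2021, §3.1 pp. 8–9] -/
theorem not_hasOnlyRealZeros_Ht_of_approx (hk : 0 < D.numGamma) {t : ℝ} (ht : t < 0)
    (hN2 : ∀ a b : ℝ, a ≤ b → ∀ ε : ℝ, 0 < ε → ∃ y₀ : ℝ, ∀ s : ℂ, a ≤ s.re → s.re ≤ b → y₀ ≤ s.im →
      ‖D.xiDeformed t (D.dobnerJ t s) - D.dobnerGammaT t s * D.Ft t s‖ ≤ ε * ‖D.dobnerGammaT t s‖) :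
    ¬ HasOnlyRealZeros (D.Ht t) := by
  intro hreal
  -- a zero of `F_t` and a small circle around it free of zeros
  obtain ⟨s₀, hs₀⟩ := D.Ft_exists_zero hk ht
  set Z : ℂ → ℂ := D.Ft t with hZ
  have hZd : Differentiable ℂ Z := D.differentiable_Ft ht
  have hZne : ∃ x : ℂ, Z x ≠ 0 := D.exists_Ft_ne_zero hk ht
  have hiso : ∀ᶠ z in 𝓝[≠] s₀, Z z ≠ 0 := by
    rcases (hZd.analyticAt s₀).eventually_eq_zero_or_eventually_ne_zero with h | h
    · exfalso
      obtain ⟨x, hx⟩ := hZne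
      have hall := (hZd.differentiableOn.analyticOnNhd isOpen_univ).eqOn_zero_of_preconnected_of_eventuallyEq_zero
        isPreconnected_univ (mem_univ s₀) h
      exact hx (hall (mem_univ x))
    · exact h
  obtain ⟨ρ, hρ, hρZ⟩ : ∃ ρ > 0, ∀ z : ℂ, 0 < dist z s₀ → dist z s₀ < ρ → Z z ≠ 0 := by
    rw [eventually_nhdsWithin_iff, Metric.eventually_nhds_iff] at hiso
    obtain ⟨ρ, hρ, h⟩ := hiso
    exact ⟨ρ, hρ, fun z h0 hlt ↦ h hlt (dist_pos.1 h0)⟩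
  set r : ℝ := min (ρ / 2) 1 with hr
  have hr0 : 0 < r := lt_min (half_pos hρ) one_pos
  have hr1 : r ≤ 1 := min_le_right _ _
  have hsphere : ∀ z ∈ sphere s₀ r, Z z ≠ 0 := fun z hz ↦ by
    rw [mem_sphere] at hz
    exact hρZ z (by rw [hz]; exact hr0) (by rw [hz]; exact (min_le_left _ _).trans_lt (half_lt_self hρ))
  -- heights: above the pole height and where `Re J_t > 1/2`
  obtain ⟨Y₁, hY₁0, hY₁⟩ := D.exists_lt_dobnerJ_re hk ht.ne (s₀.re - 1) (1 / 2)
  set Y : ℝ := Y₁ + D.poleHeight + |s₀.im| + 2 with hY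
  have hP0 := D.poleHeight_nonneg
  have hT : ∀ m : ℕ, ∃ T : ℝ, Y ≤ T ∧
      (∀ s : ℂ, s ∈ closedBall s₀ r → ‖Z s - Z (s + T * I)‖ < 1 / (m + 1)) ∧
      (∀ s : ℂ, s ∈ closedBall s₀ r →
        ‖D.xiDeformed t (D.dobnerJ t (s + T * I)) - D.dobnerGammaT t (s + T * I) * Z (s + T * I)‖ ≤
          1 / (m + 1) * ‖D.dobnerGammaT t (s + T * I)‖) := by
    intro m
    have hε : (0 : ℝ) < 1 / (m + 1) := by positivity
    obtain ⟨y₀, hy₀⟩ := hN2 (s₀.re - 1) (s₀.re + 1) (by linarith) (1 / (m + 1)) hε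
    obtain ⟨τ, -, -, ⟨δ, hδ, hgap⟩, -, hτ⟩ := bohr_almost_periodic_holds (D.deformedCoeff t)
      (s₀.re - 1) (s₀.re + 1) (1 / (m + 1))
      (by rw [D.abscissaOfAbsConv_deformedCoeff ht]; exact EReal.bot_lt_coe _) (by linarith) hε
    obtain ⟨k, hk'⟩ := exists_ge_of_gaps hδ hgap (max Y (y₀ + |s₀.im| + 1))
    refine ⟨τ k, (le_max_left _ _).trans hk', fun s hs ↦ ?_, fun s hs ↦ ?_⟩
    · have hre : |s.re - s₀.re| ≤ 1 := (abs_re_im_sub_le_of_mem_closedBall hs).1.trans hr1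
      obtain ⟨h1, h2⟩ := abs_le.1 hre
      exact hτ k s (by linarith) (by linarith)
    · have hre : |s.re - s₀.re| ≤ 1 := (abs_re_im_sub_le_of_mem_closedBall hs).1.trans hr1
      have him : |s.im - s₀.im| ≤ 1 := (abs_re_im_sub_le_of_mem_closedBall hs).2.trans hr1
      obtain ⟨h1, h2⟩ := abs_le.1 hre
      obtain ⟨h3, h4'⟩ := abs_le.1 him
      refine hy₀ (s + τ k * I) (by simp; linarith) (by simp; linarith) ?_
      simp only [Complex.add_im, Complex.mul_im, Complex.ofReal_re, Complex.I_im, mul_one,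
        Complex.ofReal_im, Complex.I_re, mul_zero, add_zero]
      have := (le_max_right _ _).trans hk'
      linarith [le_abs_self s₀.im, neg_abs_le s₀.im]
  choose T hTY hTbohr hTapprox using hT
  -- the functions `g_m`
  set g : ℕ → ℂ → ℂ := fun m s ↦
    D.xiDeformed t (D.dobnerJ t (s + T m * I)) * (D.dobnerGammaT t (s + T m * I))⁻¹ with hg
  -- after the shift the disc lies above the pole height and above `Y₁`
  have him_shift : ∀ m : ℕ, ∀ s ∈ closedBall s₀ r, D.poleHeight < (s + T m * I).im ∧
      Y₁ ≤ (s + T m * I).im := by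
    intro m s hs
    have him : |s.im - s₀.im| ≤ 1 := (abs_re_im_sub_le_of_mem_closedBall hs).2.trans hr1
    obtain ⟨h3, h4'⟩ := abs_le.1 him
    simp only [Complex.add_im, Complex.mul_im, Complex.ofReal_re, Complex.I_im, mul_one,
      Complex.ofReal_im, Complex.I_re, mul_zero, add_zero]
    have hY' : Y ≤ T m := hTY m
    rw [hY] at hY'
    constructor <;> linarith [le_abs_self s₀.im, neg_abs_le s₀.im]
  -- uniform convergence `g_m → F_t` on the closed disc
  have hunif : TendstoUniformlyOn g Z atTop (closedBall s₀ r) := by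
    rw [Metric.tendstoUniformlyOn_iff]
    intro ε hε
    obtain ⟨M, hM⟩ := exists_nat_gt (2 / ε)
    filter_upwards [eventually_ge_atTop M] with m hm s hs
    have hm' : (2 : ℝ) / ε < m + 1 := hM.trans (by exact_mod_cast Nat.lt_succ_of_le hm)
    have hεm : 2 * (1 / ((m : ℝ) + 1)) < ε := by
      rw [div_lt_iff₀ hε] at hm'
      rw [mul_one_div, div_lt_iff₀ (by positivity)]
      linarith
    set s' : ℂ := s + T m * I with hs'
    have hs'im : D.poleHeight < s'.im := (him_shift m s hs).1
    have hγ : D.dobnerGammaT t s' ≠ 0 := D.dobnerGammaT_ne_zero t hs'im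
    have e1 : ‖g m s - Z s'‖ ≤ 1 / (m + 1) := by
      have hgs' : g m s = D.xiDeformed t (D.dobnerJ t s') * (D.dobnerGammaT t s')⁻¹ := rfl
      have : g m s - Z s' = (D.dobnerGammaT t s')⁻¹ *
          (D.xiDeformed t (D.dobnerJ t s') - D.dobnerGammaT t s' * Z s') := by
        rw [hgs']
        field_simp
      rw [this, norm_mul, norm_inv]
      have h := hTapprox m s hs
      rw [← hs'] at h
      calc ‖D.dobnerGammaT t s'‖⁻¹ * ‖D.xiDeformed t (D.dobnerJ t s') - D.dobnerGammaT t s' * Z s'‖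
          ≤ ‖D.dobnerGammaT t s'‖⁻¹ * (1 / (m + 1) * ‖D.dobnerGammaT t s'‖) := by gcongr
        _ = 1 / (m + 1) := by field_simp [norm_ne_zero_iff.2 hγ]
    have e2 : ‖Z s - Z s'‖ < 1 / (m + 1) := hTbohr m s hs
    calc dist (Z s) (g m s) = ‖(Z s - Z s') - (g m s - Z s')‖ := by
          rw [dist_eq_norm]; congr 1; ring
      _ ≤ ‖Z s - Z s'‖ + ‖g m s - Z s'‖ := norm_sub_le _ _
      _ < 1 / (m + 1) + 1 / (m + 1) := add_lt_add_of_lt_of_le e2 e1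
      _ = 2 * (1 / ((m : ℝ) + 1)) := by ring
      _ < ε := hεm
  -- holomorphy of `g_m` near the disc
  have hξd := D.differentiable_xiDeformed hk ht
  have hdiff : ∀ᶠ m in atTop, DiffContOnCl ℂ (g m) (ball s₀ r) := by
    refine Eventually.of_forall fun m ↦ ?_
    have hU : IsOpen {s : ℂ | D.poleHeight < (s + T m * I).im} :=
      isOpen_lt continuous_const (Complex.continuous_im.comp (by fun_prop))
    have hsub : closedBall s₀ r ⊆ {s : ℂ | D.poleHeight < (s + T m * I).im} := fun s hs ↦
      (him_shift m s hs).1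
    have hd : DifferentiableOn ℂ (g m) {s : ℂ | D.poleHeight < (s + T m * I).im} := by
      intro s hs
      simp only [mem_setOf_eq] at hs
      refine DifferentiableAt.differentiableWithinAt ?_
      have hshift : DifferentiableAt ℂ (fun s : ℂ ↦ s + T m * I) s := by fun_prop
      have hJ : DifferentiableAt ℂ (fun s : ℂ ↦ D.dobnerJ t (s + T m * I)) s :=
        DifferentiableAt.comp (f := fun s : ℂ ↦ s + T m * I) (g := D.dobnerJ t) s
          (D.differentiableAt_dobnerJ t hs) hshift
      have hξ : DifferentiableAt ℂ (fun s : ℂ ↦ D.xiDeformed t (D.dobnerJ t (s + T m * I))) s :=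
        DifferentiableAt.comp (f := fun s : ℂ ↦ D.dobnerJ t (s + T m * I)) (g := D.xiDeformed t) s
          (hξd _) hJ
      have hγ' : DifferentiableAt ℂ (fun s : ℂ ↦ D.dobnerGammaT t (s + T m * I)) s :=
        DifferentiableAt.comp (f := fun s : ℂ ↦ s + T m * I) (g := D.dobnerGammaT t) s
          (D.differentiableAt_dobnerGammaT t hs) hshift
      have hγ : DifferentiableAt ℂ (fun s : ℂ ↦ (D.dobnerGammaT t (s + T m * I))⁻¹) s :=
        hγ'.inv (D.dobnerGammaT_ne_zero t hs)
      exact hξ.mul hγ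
    exact hd.diffContOnCl_ball hsub
  -- Hurwitz
  have hcont : ContinuousOn Z (sphere s₀ r) := hZd.continuous.continuousOn
  have hz := Complex.eventually_exists_zero_mem_ball_of_tendstoUniformlyOn hr0 hdiff hunif hcont
    hs₀ hsphere
  obtain ⟨m, s, hs, hgs⟩ := hz.exists
  -- unwind: a zero of `ξ^F_t` with real part `> 1/2`
  have hs' : s ∈ closedBall s₀ r := ball_subset_closedBall hs
  set s' : ℂ := s + T m * I with hs'def
  obtain ⟨himP, himY⟩ := him_shift m s hs'
  have hγ : D.dobnerGammaT t s' ≠ 0 := D.dobnerGammaT_ne_zero t himP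
  have hξ : D.xiDeformed t (D.dobnerJ t s') = 0 := by
    simp only [hg] at hgs
    exact (mul_eq_zero.1 hgs).resolve_right (inv_ne_zero hγ)
  have hhalf : (D.dobnerJ t s').re = 1 / 2 := (D.hasOnlyRealZeros_Ht_iff t).1 hreal _ hξ
  have hre : s₀.re - 1 ≤ s'.re := by
    have : |s.re - s₀.re| ≤ 1 := (abs_re_im_sub_le_of_mem_closedBall hs').1.trans hr1
    rw [hs'def]
    simp only [Complex.add_re, Complex.mul_re, Complex.ofReal_re, Complex.I_re, mul_zero,
      Complex.ofReal_im, Complex.I_im, mul_one, sub_self, add_zero]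
    linarith [(abs_le.1 this).1]
  have hgt : 1 / 2 < (D.dobnerJ t s').re := hY₁ s' hre himY
  linarith

end ExtendedSelbergDatum

/-- **Dobner's Thm. 2 (`Λ_F ≥ 0` for every `F ∈ 𝒮♯`, in the tree's `sInf`-free form
`Literature.NumberTheory.LFunctions.dobner_theorem2`) from the qualitative Thm. 4♯ alone** (§3.1 of
the source): if for every datum with `k ≥ 1`, every `t < 0`, every strip `a ≤ Re s ≤ b` and every
`ε > 0` one has `‖ξ^F_t(J_t(s)) − γ_t(s) F_t(s)‖ ≤ ε‖γ_t(s)‖` for `Im s` large (the frozen statement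
of `ExtendedSelbergDatum.xiDeformed_approx`, node N2 of the plan), then `dobner_theorem2`. Lemma 3♯
(`ExtendedSelbergDatum.Ft_exists_zero`) and Bohr's theorem (`bohr_almost_periodic_holds`) are
theorems of the tree; when N2 lands, `dobner_theorem2_holds := dobner_theorem2_of (fun D hk t ht ↦
D.xiDeformed_approx hk ht)` (up to binder order). RH-FREE CONTENT (reduction). [cite: Dobner2021, §3.1 pp. 8–9] -/
theorem dobner_theorem2_of
    (hN2 : ∀ (D : ExtendedSelbergDatum), 0 < D.numGamma → ∀ t : ℝ, t < 0 →
      ∀ a b : ℝ, a ≤ b → ∀ ε : ℝ, 0 < ε → ∃ y₀ : ℝ, ∀ s : ℂ, a ≤ s.re → s.re ≤ b → y₀ ≤ s.im →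
        ‖D.xiDeformed t (D.dobnerJ t s) - D.dobnerGammaT t s * D.Ft t s‖ ≤ ε * ‖D.dobnerGammaT t s‖) :
    dobner_theorem2 :=
  fun D hk t ht ↦ D.not_hasOnlyRealZeros_Ht_of_approx hk ht (hN2 D hk t ht)

end Literature.NumberTheory.LFunctions

end
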